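import Literature.NumberTheory.EllipticCurves.KellerYin2024.AnomalousLambdaInvariants
import HarnessLib

/-!
# Keller–Yin 2024 / Castella–Grossi–Lee–Skinner 2022 / Kriz 2016: the anomalous anticyclotomic congruence at a
# good Eisenstein prime GIVEN A FULL-DESCENT DATUM (every odd `p`, in particular `p = 3`)

Literature STATEMENT file (one `def … : Prop`, one PROVED bookkeeping bridge; no theorem of number theory is
asserted). Companion of `AnomalousLambdaInvariants.lean`, whose named facts `thm222_anacong_goodLattice_of_ne_one`
(CGLS Thm. 2.2.2, `φ ≠ 𝟙`, PUB), `thm222_anacong_goodLattice_of_five_le` (`5 ≤ p`, COMPOSED OF REFEREED PRINT, referee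
C3 R428 OPTION B) and `thm222_anacong_goodLattice_OPEN` (every odd `p`, the preprint claim KY Thm. 2.2.2) it refines:
`thm222_anacong_goodLattice_of_fullDescentDatum` is the body of `_OPEN` byte for byte with ONE extra hypothesis after
`Anom W p` — the FULL-DESCENT DATUM «`E` has a prime of additive reduction, or a prime `ℓ` of multiplicative reduction
that is split with `ℓ ≡ 1 (mod p)` or non-split with `ℓ + 1 ≡ 0 (mod p)`» (i.e. `a_ℓ ≡ ℓ (mod p)`), and it is the
REGISTERED STATEMENT of stub 3a-A `stub_anacongOfFullDescentDatum` of the crux-2 skeleton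
`Summits/BirchSwinnertonDyer/BirchSwinnertonDyer/Cruxes/GoodLatticeBDPValue/Lines/halves.lean` (v21/v22; ideator bsd-idea-11
g9's typed AN-3 split `Lines/halves_anThree_typedSplit_idea11g9.lean` §1–§2, critic VERDICT #59 PASS) token for token.

WHY THIS IS (A COMPOSITION OF) REFEREED PRINT — the same species as `_of_five_le`, with ONE sentence of Kriz's Remark 33
swapped. CGLS 2022 prove Thm. 2.2.1 (Kriz's congruence `𝓛_E ≡ (𝓔_{φ,ψ})²·(𝓛_φ)²`) from the congruence of modular
forms `f ≡ G = E₂^{φ,φ⁻¹,(N)} (mod p)` ((eq:cong-mf): «By [Kriz], our hypothesis on `E[p]` implies that there is a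
congruence `f ≡ G`», arXiv:2008.02571 §2.2, proof of Thm. 2.2.1 [corpus: paper:arxiv-2008.02571 p0012]) and Thm. 2.2.2
from Thm. 2.2.1, Hida's `μ = 0` and the Katz functional equation (2.16) — steps that are uniform in `p > 2`. The
congruence `f ≡ G` INCLUDING THE CONSTANT TERM is Kriz's FULL Eisenstein descent (Kriz 2016 Def. 31 with condition (5),
Rem. 32: «When `f` has full Eisenstein descent, this congruence holds for `j ≥ 0`» [corpus: paper:arxiv-1512.05032 p0020
L30–L69]); Kriz Thm. 35 with Thm. 34 (3) gives PARTIAL descent of type `(ψ₁, ψ₂, N₊, N₋, N₀)` for every `E/ℚ` with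
`E[p]` reducible, where «`N₋` [is] any product of `ℓ ∥ N` satisfying `a_ℓ ≡ ψ₂(ℓ)ℓ^{k−1}`» and `N₀` is the squarefull
part of `N` [p0021 L27–L33, p0022 L19–L26]; and Rem. 33 upgrades partial to full descent: if `ψ₁ ≠ 𝟙` condition (5)
holds; if `ψ₁ = ψ₂ = 𝟙` (the case `φ = 𝟙`, trivial nebentypus, `k = 2`) «(5) is still forced to hold unless
`N₋N₀ = 1`» — this sentence is `p`-FREE (the factors `∏_{ℓ∣N₋}(1 − ψ₂(ℓ))·∏_{ℓ∣N₀}(…)(1 − ψ₂(ℓ))` of (5) vanish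
identically) [p0020 L71 – p0021 L1]; only the residual sub-case `N₋N₀ = 1` needs Rem. 33's `θ`-injectivity sentence
«Suppose `p > k + 1`» (the reason `_of_five_le` stops at `5 ≤ p`). The full-descent datum of this declaration says
exactly `N₀ ≠ 1` (an additive prime) or that some multiplicative `ℓ` with `a_ℓ ≡ ℓ (mod p)` may be placed in `N₋`, so
`N₋N₀ ≠ 1`, (5) holds, `f` has FULL Eisenstein descent, (eq:cong-mf) holds as used, and CGLS's printed proofs of
Thms. 2.2.1/2.2.2 run verbatim at every odd `p`, INCLUDING `p = 3`. (For `φ ≠ 𝟙` the statement is implied by the PUB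
sibling `_of_ne_one`; for `5 ≤ p` by `_of_five_le`; the new content is `(p, φ) = (3, 𝟙)`.) REMARK (not used here): by the
tree theorem `Summit.…Theorems.GoodLatticeBDPValueFullDescentStub.stub_fullDescentAtThreeOfRed` (LEAD bsd-line-x1-p1 g5,
2026-08-28, unconditional) the datum ALWAYS exists when `3` is a good prime with `E[3]` reducible.

STATUS / HONEST FRAMING: named fact (D-0014) — a `Prop`, nothing asserted, no `sorry`, no instance, no notation; label at
filing: «PUB-COMPOSED CANDIDATE» — the ARM P referee C3's ruling on exactly this composition (cell bsd-eis host RECORD #80/#86,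
pub-bsdpct INBOX l.904) is PENDING; consumers (crux 2 `GoodLatticeBDPValue`, stub 3a-A) re-point by their owners. NEVER cite
this `Prop` as a theorem. No summit statement / BSD / IMC / Keller–Yin theorem is proved by this file.

References: D. Kriz, *Generalized Heegner cycles at Eisenstein primes and the Katz p-adic L-function*, Algebra Number Theory
10 (2016) 309–374, Def. 31, Rem. 32, Rem. 33, Thm. 34, Thm. 35, Thm. 27; F. Castella, G. Grossi, J. Lee, C. Skinner, *On the
anticyclotomic Iwasawa theory of rational elliptic curves at Eisenstein primes*, Invent. Math. 227 (2022), Thms. 2.2.1, 2.2.2,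
(2.16); H. Hida, *The Iwasawa μ-invariant of p-adic Hecke L-functions*, Ann. of Math. 172 (2010), Thm. I; T. Keller, M. Yin,
arXiv:2402.12781v2, Thm. 2.2.2 (statement shape only).
-/


noncomputable section

open scoped Classical

open WeierstrassCurve NumberField IsDedekindDomain Field Polynomial
  Literature.NumberTheory.EllipticCurves Literature.NumberTheory.EllipticCurves.ModularForms
  Literature.NumberTheory.QuadraticFields Literature.NumberTheory.EllipticCurves.Rank1Residual
  Literature.NumberTheory.EllipticCurves.Castella2018 Literature.NumberTheory.EllipticCurves.GreenbergSelmer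
  Literature.NumberTheory.EllipticCurves.GreenbergVatsal2000 Literature.NumberTheory.GaloisRepresentations
  Literature.NumberTheory.EllipticCurves.CastellaGrossiLeeSkinner2022

namespace Literature.NumberTheory.EllipticCurves.KellerYin2024

/-- **Castella–Grossi–Lee–Skinner 2022 Thms. 2.2.1/2.2.2 with (2.16) ∘ Kriz 2016 (Thm. 35, Thm. 34 (3), Def. 31 (5),
Rem. 32, Rem. 33 first part) ∘ Hida 2010: the anomalous-congruence good-lattice ANALYTIC statement WITHOUT «`φ ≠ 𝟙`», at
EVERY odd `p`, GIVEN A FULL-DESCENT DATUM — COMPOSED OF REFEREED PRINT (candidate; referee C3 ruling pending).** Statement: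
the body of `thm222_anacong_goodLattice_OPEN` byte for byte with the extra hypothesis, inserted after `Anom W p`,
«`(∃ ℓ prime, Addv W ℓ) ∨ (∃ ℓ prime, W.HasMultiplicativeReductionAtPrime ℓ ∧ ((W.HasSplitMultiplicativeReductionAtPrime ℓ
∧ ℓ ≡ 1 [MOD p]) ∨ (¬ W.HasSplitMultiplicativeReductionAtPrime ℓ ∧ ℓ + 1 ≡ 0 [MOD p])))`» (= `a_ℓ ≡ ℓ (mod p)` at a
multiplicative `ℓ`: Kriz's `N₋ ≠ 1`; an additive prime: `N₀ ≠ 1`). WHY PRINT: CGLS's proof of Thm. 2.2.1 uses its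
hypothesis only to get the congruence of forms `f ≡ E₂^{φ,φ⁻¹,(N)}` ((eq:cong-mf)) from [Kriz]; Kriz Thm. 35 + 34 (3) give
partial Eisenstein descent of a type `(ψ₁,ψ₂,N₊,N₋,N₀)` with `N₋ ∋` every chosen multiplicative `ℓ` with
`a_ℓ ≡ ψ₂(ℓ)ℓ`, `N₀` = squarefull part; Rem. 33: for `ψ₁ ≠ 𝟙` condition (5) of Def. 31 holds, and for `ψ₁ = ψ₂ = 𝟙`
«(5) is still forced to hold unless `N₋N₀ = 1`» (p-free: the `N₋`/`N₀` factors of (5) vanish) — so under the datum `f`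
has FULL descent, i.e. `f ≡ E₂^{ψ₁,ψ₂,(N)}` for `j ≥ 0` (Rem. 32), and CGLS Thms. 2.2.1/2.2.2 (Hida `μ = 0`, Katz
functional equation (2.16) = Kriz Thm. 27) run verbatim for every `p > 2`. The sibling `_of_five_le` is the same
composition with Rem. 33's «`p > k + 1`» sentence in place of the datum; `_of_ne_one` covers `φ ≠ 𝟙`; the new content is
`(p, φ) = (3, 𝟙)` with a datum. This is the registered statement of stub 3a-A `stub_anacongOfFullDescentDatum` of
`Cruxes/GoodLatticeBDPValue/Lines/halves.lean` (bsd-idea-11 g9's AN-3 split), token for token. Named fact (D-0014):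
nothing asserted.
[cite: CastellaGrossiLeeSkinner2022, Thm. 2.2.1 (thm:kriz) and its proof ((eq:cong-mf) «By [Kriz] … f ≡ G»), Thm. 2.2.2 (cor:Kriz) with (2.16) (arXiv:2008.02571v2 TeX L1051–1153; Invent. Math. 227 (2022) §2.2)]
[cite: Kriz2016, Def. 31 with (5), Rem. 32, Rem. 33 (first part: ψ₁ ≠ 𝟙 ⇒ (5); ψ₁ = ψ₂ = 𝟙 ⇒ «(5) is still forced to hold unless N₋N₀ = 1»), Thm. 34 (3), Thm. 35, Thm. 27 — ANT 10 (2016) 309–374, pp. 328–330]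
[cite: Hida2010MuInvariant, Thm. I (μ = 0, as used in CGLS's proof of Thm. 2.2.2)]
[cite: KellerYin2024, Thm. 2.2.2 (anacong; arXiv:2402.12781v2 TeX L1445–1448) — the statement's SHAPE only; no step of the preprint is used] -/
def thm222_anacong_goodLattice_of_fullDescentDatum : Prop :=
  ∀ (W : WeierstrassCurve ℚ) [W.IsElliptic] [W.IsGloballyMinimal] (p : ℕ) [Fact p.Prime],
    2 < p → Good W p → Red W p → Anom W p →
    ((∃ (ℓ : ℕ) (hℓ : ℓ.Prime), haveI : Fact ℓ.Prime := ⟨hℓ⟩; Addv W ℓ) ∨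
      (∃ (ℓ : ℕ) (hℓ : ℓ.Prime), haveI : Fact ℓ.Prime := ⟨hℓ⟩;
        W.HasMultiplicativeReductionAtPrime ℓ ∧
          ((W.HasSplitMultiplicativeReductionAtPrime ℓ ∧ ℓ ≡ 1 [MOD p]) ∨
            (¬ W.HasSplitMultiplicativeReductionAtPrime ℓ ∧ ℓ + 1 ≡ 0 [MOD p])))) →
    (∀ Φ : AddSubgroup (geomTorsion W (p : ℤ)), IsRationalLine W p Φ → ¬ LineUnramifiedAt W p Φ) →
    ∀ (K : Type) [Field K] [NumberField K], IsImaginaryQuadratic K →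
      SatisfiesHeegnerHypothesis (W.conductorNorm ℤ) K → SatisfiesHeegnerHypothesis p K →
      Odd (NumberField.discr K) → NumberField.discr K ≠ -3 →
      (∀ Q : (W.baseChange K).toAffine.Point, p • Q = 0 → Q = 0) →
    ∀ (ι : K →+* ℚ_[p]) (v vbar : HeightOneSpectrum (𝓞 K)),
      (∀ x : 𝓞 K, x ∈ v.asIdeal ↔ ‖ι (x : K)‖ < 1) →
      ((p : ℕ) : 𝓞 K) ∈ vbar.asIdeal → vbar ≠ v →
    ∀ (κ : ZpExtension K p), κ.IsAnticyclotomic →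
    ∀ (γ : absoluteGaloisGroup K) [Fact (κ.IsTopGenerator γ)],
    ∀ (N : ℕ) [NeZero N] (Dt : ModularParametrizationData W N),
    ∀ (ι' : PadicAlgCl p ≃+* ℂ),
      (∀ (w : InfinitePlace K) (k : 𝓞 K), k ∈ v.asIdeal ↔ ‖ι'.symm (w.embedding (k : K))‖ < 1) →
    ∀ (ΩK : ℂ) (Ωp : (unrIntegers p)ˣ) (L : UnrSeries p), ΩK ≠ 0 →
      IsBDPLFunction ι' v κ γ Dt.f ΩK ((Ωp : unrIntegers p) : ℂ_[p]) L →
    ∀ (θsub θquot : FramedGaloisRep K (padicCoeffIntegers (∅ : Set (PadicAlgCl p))) 1),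
      IsResidualPairOver (W.baseChange K) p θsub θquot →
    ∀ (Sf : Finset (HeightOneSpectrum (𝓞 K))),
      (∀ w : HeightOneSpectrum (𝓞 K), w ∈ Sf ↔ ((W.conductorNorm ℤ : ℤ) : 𝓞 K) ∈ w.asIdeal) →
    ∀ (θK : HeckeCharacter K), IsHeckeCharOf ι' θquot θK →
    ∀ (Cbar : Finset (HeightOneSpectrum (𝓞 K))), (∀ u ∈ Cbar, ¬ θK.IsUnramifiedAt u) →
    ∀ (ΩK' : ℂ) (Ωp' : (unrIntegers p)ˣ) (Lφ : UnrSeries p), ΩK' ≠ 0 →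
      IsKatzLFunction ι' v vbar Cbar κ γ θK ΩK' ((Ωp' : unrIntegers p) : ℂ_[p]) Lφ →
    ∃ n nφ : ℕ, FirstUnitCoeffAt L n ∧ FirstUnitCoeffAt Lφ nφ ∧
      n + ∑ w ∈ Sf, curveLocalLambda κ (W.baseChange K) w =
        2 * nφ + ∑ w ∈ Sf, (charLocalLambda ∅ κ θsub w + charLocalLambda ∅ κ θquot w)

/-- **Bridge, PROVED (bookkeeping)**: the preprint claim at every odd `p` (`thm222_anacong_goodLattice_OPEN`) implies the
full-descent-datum statement (one hypothesis dropped). [cite: KellerYin2024, Thm. 2.2.2 (arXiv:2402.12781v2 TeX L1445–1448)] -/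
theorem thm222_anacong_goodLattice_OPEN.of_fullDescentDatum (h : thm222_anacong_goodLattice_OPEN) :
    thm222_anacong_goodLattice_of_fullDescentDatum :=
  fun W _ _ p _ hp hgood hred hanom _ hlat K _ _ hK hH hHp hodd hd3 htor ι v vbar hv hvbar hne κ hκ γ _
      N _ Dt ι' hι' ΩK Ωp L hΩ hL θsub θquot hpair Sf hSf θK hθK Cbar hC ΩK' Ωp' Lφ hΩ' hLφ ↦
    h W p hp hgood hred hanom hlat K hK hH hHp hodd hd3 htor ι v vbar hv hvbar hne κ hκ γ N Dt ι' hι'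
      ΩK Ωp L hΩ hL θsub θquot hpair Sf hSf θK hθK Cbar hC ΩK' Ωp' Lφ hΩ' hLφ

end Literature.NumberTheory.EllipticCurves.KellerYin2024

end
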